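import Literature.Analysis.FluidPDE.SolenoidalL2Duality
import Literature.Analysis.FluidPDE.L2DualityTools
import HarnessLib

/-!
# The `div`–`curl` annihilator lemma in `L^p + L^q(ℝⁿ)` and `L²` bounds by duality with curls

Analysis/FluidPDE support file in the discharge of the class assertion of Galdi's theorem
(`Literature.Analysis.FluidPDE.galdi_lerayHopf_class`, `FluidPDE/NSGaldiEnergyEquality`; Galdi 2019,
Proc. AMS 147, Thm. 1.1), step "`v(t) ∈ L²` with `‖v(t)‖₂ ≤ A` for a.e. `t`". The duality proof
in the tree tests the very weak Navier–Stokes formulation only against **curl-type** fields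
`x ↦ (∂ₐg)(x) c - (∂_c g)(x) a` (`g` a scalar test function, `a, c ∈ E`; these are divergence
free for every `g`, so cut-offs can be placed inside the curl, `FluidPDE/NSGaldiExtendedTest`),
and therefore sees the solution slice `v(t)` only through the pairings `∫ ⟪v(t), φ⟫` with `φ` in
the span `𝒦` of such fields — a proper subspace of the divergence-free tests `𝒱` in general.
This file shows that for a weakly divergence-free field this is as good as testing with all of
`𝒱` (the tree's `FluidPDE/SolenoidalL2Duality`, `FluidPDE/HelmholtzAnnihilator`):

* `Literature.Analysis.FluidPDE.ae_eq_zero_of_forall_integral_laplacian_mul_inner_eq_zero` —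
  **Weyl–Liouville in `L^p + L^q`**: a field `w = w₁ + w₂ ∈ L^p + L^q(E; E)`, `1 < p, q < ∞`,
  all of whose components are *weakly harmonic* (`∫ Δθ ⟪w, a⟫ = 0` for scalar tests `θ`)
  vanishes a.e. (the engine of the tree's annihilator lemma, isolated: mollify, Liouville for
  `L^p + L^q` harmonic functions, Lebesgue differentiation).
* `Literature.Analysis.FluidPDE.integral_laplacian_mul_inner_eq_zero_of_curlPair` — a locally
  integrable, weakly divergence-free field annihilating all curl-type fields has weakly harmonic
  components: pointwise `(Δθ) a = ∇(∂ₐθ) + Σᵢ [(∂ᵢ∂ᵢθ) a - (∂ₐ∂ᵢθ) eᵢ]` (Schwarz), the weak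
  form of `-ΔF = curl curl F - ∇ div F`.
* `Literature.Analysis.FluidPDE.IsWeaklyDivFree.ae_eq_zero_of_add_memLp_of_forall_integral_inner_curlPair_eq_zero`
  — **`div`–`curl` annihilator lemma**: `w ∈ L^p + L^q` weakly divergence free and weakly
  irrotational (`⊥` all curl-type fields) is `0` a.e. (Lemarié-Rieusset 2016, proof of Thm. 4.4,
  pp. 56–57: "solenoidal and irrotational ⇒ harmonic ⇒ `0`").
* `Literature.Analysis.FluidPDE.memLp_two_of_forall_abs_integral_inner_curlPair_le` — **`L²`
  bounds by duality with curls**: if `f ∈ L^p(E; E)`, `1 < p < ∞`, is weakly divergence free and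
  `|∫ ⟪f, φ⟫| ≤ A ‖φ‖_{L²}` for all `φ ∈ 𝒦`, then `f ∈ L²` and `‖f‖_{L²} ≤ A` (Riesz on the
  closure of `𝒦`, `FluidPDE/L2DualityTools`, then the annihilator lemma for `h - f`).

No new definitions: the class `𝒦` appears as the `Submodule.span` of an explicitly described set.

## Mathlib / tree search

Mathlib (this pin): no Helmholtz decomposition, no `div`/`curl` calculus for vector fields on
inner product spaces (searched `curl`, `solenoidal`, `irrotational`). Tree: the annihilator lemma
for `𝒱` (`IsWeaklyDivFree.ae_eq_zero_of_add_memLp_of_forall_integral_inner_eq_zero`) and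
Liouville in `L^p + L^q` (`HarmonicOnNhd.eq_zero_of_eq_add_memLp`) in
`FluidPDE/HelmholtzAnnihilator`, whose proof is followed here with the weaker hypothesis; the
`L²`-duality lemma for `𝒱` (`memLp_two_of_forall_abs_integral_inner_le`, `SolenoidalL2Duality`).

## References

* P. G. Lemarié-Rieusset, *The Navier–Stokes problem in the 21st century*, CRC Press 2016,
  Thm. 4.4 and its proof, pp. 56–57 (`LemarieRieusset2016`).
* M. Hieber, *Analysis of viscous fluid flows: an approach by evolution equations*, LNM 2254
  (2020), §1.10 (`Hieber2020`).
* G. P. Galdi, *On the energy equality for distributional solutions to Navier–Stokes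
  equations*, Proc. AMS 147 (2019) 785–792, Thm. 1.1 (`Galdi2018`; the fact served).
-/

noncomputable section

open MeasureTheory TopologicalSpace Set Function Filter Topology InnerProductSpace
  ContinuousLinearMap Metric
open scoped RealInnerProductSpace ENNReal NNReal Convolution ContDiff Laplacian

namespace Literature.Analysis.FluidPDE

variable {E : Type*} [NormedAddCommGroup E] [InnerProductSpace ℝ E] [FiniteDimensional ℝ E]
  [MeasurableSpace E] [BorelSpace E]

/-! ### Weyl–Liouville: weakly harmonic `L^p + L^q` fields vanish -/

section WeylLiouville

/-- **Weyl–Liouville in `L^p + L^q`.** Let `1 < p, q < ∞` and `w = w₁ + w₂` with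
`w₁ ∈ L^p(E; E)`, `w₂ ∈ L^q(E; E)`. If every component of `w` is weakly harmonic,
`∫ (Δθ) ⟪w, a⟫ = 0` for all scalar test functions `θ` and all `a ∈ E`, then `w = 0` a.e.
Proof as in the tree's annihilator lemma (Lemarié-Rieusset 2016, proof of Thm. 4.4, pp. 56–57,
run on mollifications): `hₖ = φₖ ⋆ ⟪w, a⟫` is smooth with
`Δhₖ(x) = ∫ Δ(φₖ(x - ·)) ⟪w, a⟫ = 0`, lies in `L^p + L^q` (Young), hence vanishes by Liouville
(`HarmonicOnNhd.eq_zero_of_eq_add_memLp`); and `hₖ → ⟪w, a⟫` a.e. [cite: LemarieRieusset2016, proof of Thm. 4.4 (uniqueness part) pp. 56–57] -/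
theorem ae_eq_zero_of_forall_integral_laplacian_mul_inner_eq_zero {p q : ℝ≥0∞}
    (hp : 1 < p) (hp' : p < (⊤ : ℝ≥0∞)) (hq : 1 < q) (hq' : q < (⊤ : ℝ≥0∞)) {w₁ w₂ : E → E}
    (hw₁ : MemLp w₁ p (volume : Measure E)) (hw₂ : MemLp w₂ q (volume : Measure E))
    (hharm : ∀ θ : E → ℝ, FunctionSpaces.IsTestFunctionOn (⊤ : Opens E) θ → ∀ a : E,
      ∫ x, (Δ θ) x * ⟪(w₁ + w₂) x, a⟫ = 0) :
    w₁ + w₂ =ᵐ[volume] 0 := by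
  rcases subsingleton_or_nontrivial E with hE | hE
  · exact Eventually.of_forall fun x => Subsingleton.elim _ _
  have hp1 : 1 ≤ p := hp.le
  have hq1 : 1 ≤ q := hq.le
  set b := stdOrthonormalBasis ℝ E
  set w : E → E := w₁ + w₂ with hw_def
  -- every component `⟪w, a⟫` vanishes a.e.
  have hcomp : ∀ a : E, ∀ᵐ y ∂(volume : Measure E), ⟪w y, a⟫ = 0 := by
    intro a
    set wa : E → ℝ := fun y => ⟪w y, a⟫ with hwa_def
    set wa₁ : E → ℝ := fun y => ⟪w₁ y, a⟫ with hwa₁_def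
    set wa₂ : E → ℝ := fun y => ⟪w₂ y, a⟫ with hwa₂_def
    have hwa₁ : MemLp wa₁ p volume := hw₁.inner_const a
    have hwa₂ : MemLp wa₂ q volume := hw₂.inner_const a
    have hwa₁l : LocallyIntegrable wa₁ volume := hwa₁.locallyIntegrable hp1
    have hwa₂l : LocallyIntegrable wa₂ volume := hwa₂.locallyIntegrable hq1
    have hwa_eq : wa = wa₁ + wa₂ := by
      funext y
      simp only [hwa_def, hwa₁_def, hwa₂_def, hw_def, Pi.add_apply, inner_add_left]
    have hwal : LocallyIntegrable wa volume := by rw [hwa_eq]; exact hwa₁l.add hwa₂l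
    obtain ⟨φ, hφ0, hφ2⟩ := FunctionSpaces.exists_contDiffBump_seq (E := E)
    -- each mollification `φₖ ⋆ wa` is a harmonic function in `L^p + L^q`, hence zero
    have hzero : ∀ (k : ℕ) (x : E), ((φ k).normed volume ⋆[lsmul ℝ ℝ, volume] wa) x = 0 := by
      intro k
      set ψ : E → ℝ := (φ k).normed volume with hψ_def
      have hψ : FunctionSpaces.IsTestFunctionOn (⊤ : Opens E) ψ :=
        FunctionSpaces.isTestFunctionOn_normed (φ k)
      have hψ2 : ContDiff ℝ 2 ψ := contDiff_infty.1 hψ.contDiff 2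
      have hh2 : ContDiff ℝ 2 (ψ ⋆[lsmul ℝ ℝ, volume] wa) :=
        hψ.hasCompactSupport.contDiff_convolution_left _ hψ2 hwal
      have hΔ : ∀ x, Δ (ψ ⋆[lsmul ℝ ℝ, volume] wa) x = 0 := by
        intro x
        rw [laplacian_convolution_lsmul hψ2 hψ.hasCompactSupport hwal x, convolution_def]
        simp only [lsmul_apply, smul_eq_mul]
        have e := integral_sub_left_eq_self (fun t => (Δ ψ) t * wa (x - t)) volume x
        simp only [sub_sub_cancel] at e
        rw [← e]
        have hθ : FunctionSpaces.IsTestFunctionOn (⊤ : Opens E) (fun z => ψ (x - z)) :=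
          hψ.comp_sub_left x
        have key := hharm _ hθ a
        simp_rw [laplacian_comp_sub_left hψ2 x] at key
        exact key
      have hharmk : HarmonicOnNhd (ψ ⋆[lsmul ℝ ℝ, volume] wa) univ := fun x _ =>
        ⟨hh2.contDiffAt, Eventually.of_forall fun y => hΔ y⟩
      have hsplit : ψ ⋆[lsmul ℝ ℝ, volume] wa =
          ψ ⋆[lsmul ℝ ℝ, volume] wa₁ + ψ ⋆[lsmul ℝ ℝ, volume] wa₂ := by
        funext x
        rw [hwa_eq, Pi.add_apply]
        exact (hψ.hasCompactSupport.convolutionExists_left _ hψ.contDiff.continuous hwa₁l x)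
          |>.distrib_add
          (hψ.hasCompactSupport.convolutionExists_left _ hψ.contDiff.continuous hwa₂l x)
      have hm₁ : MemLp (ψ ⋆[lsmul ℝ ℝ, volume] wa₁) p volume :=
        FunctionSpaces.memLp_normed_convolution (φ k) hwa₁ hp1
      have hm₂ : MemLp (ψ ⋆[lsmul ℝ ℝ, volume] wa₂) q volume :=
        FunctionSpaces.memLp_normed_convolution (φ k) hwa₂ hq1
      have h0 := hharmk.eq_zero_of_eq_add_memLp hsplit hp hp' hq hq' hm₁ hm₂
      exact fun x => congrFun h0 x
    have hlim := FunctionSpaces.ae_tendsto_normed_convolution hφ0 hφ2 hwal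
    filter_upwards [hlim] with x hx
    simp_rw [hzero] at hx
    exact tendsto_nhds_unique hx tendsto_const_nhds
  -- assemble along an orthonormal frame
  have hall : ∀ᵐ y ∂(volume : Measure E), ∀ i, ⟪w y, b i⟫ = 0 :=
    ae_all_iff.2 fun i => hcomp (b i)
  filter_upwards [hall] with y hy
  rw [Pi.zero_apply, ← b.sum_repr' (w y)]
  exact Finset.sum_eq_zero fun i _ => by rw [real_inner_comm, hy i, zero_smul]

end WeylLiouville

/-! ### Curl-type fields and weak harmonicity -/

section CurlPair

omit [MeasurableSpace E] [BorelSpace E] [FiniteDimensional ℝ E] in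
/-- The curl-type field `x ↦ (∂ₐg)(x) c - (∂_c g)(x) a` of a scalar test function `g` is a
(vector) test function. [folklore] -/
theorem isTestFunctionOn_curlPair {g : E → ℝ} (hg : FunctionSpaces.IsTestFunctionOn (⊤ : Opens E) g)
    (a c : E) :
    FunctionSpaces.IsTestFunctionOn (⊤ : Opens E) fun x => fderiv ℝ g x a • c - fderiv ℝ g x c • a where
  contDiff := ((hg.fderiv_apply_const a).contDiff.smul contDiff_const).sub
    ((hg.fderiv_apply_const c).contDiff.smul contDiff_const)
  hasCompactSupport := ((hg.fderiv_apply_const a).hasCompactSupport.smul_right (f' := fun _ => c)).sub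
    ((hg.fderiv_apply_const c).hasCompactSupport.smul_right (f' := fun _ => a))
  tsupport_subset := by simp

omit [MeasurableSpace E] [BorelSpace E] in
/-- The curl-type field of a scalar `C²` function is divergence free:
`div ((∂ₐg) c - (∂_c g) a) = ∂_c∂ₐg - ∂ₐ∂_c g = 0` (Schwarz). [folklore] -/
theorem isDivFree_curlPair_of_contDiff {g : E → ℝ} (hg : ContDiff ℝ 2 g) (a c : E) :
    VectorCalculus.IsDivFree fun x => fderiv ℝ g x a • c - fderiv ℝ g x c • a := by
  intro x
  have hda : DifferentiableAt ℝ (fun y => fderiv ℝ g y a) x :=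
    (((hg.fderiv_right (m := 1) le_rfl).clm_apply contDiff_const).differentiable one_ne_zero) x
  have hdc : DifferentiableAt ℝ (fun y => fderiv ℝ g y c) x :=
    (((hg.fderiv_right (m := 1) le_rfl).clm_apply contDiff_const).differentiable one_ne_zero) x
  have h1 : DifferentiableAt ℝ (fun y => fderiv ℝ g y a • c) x := hda.smul (differentiableAt_const c)
  have h2 : DifferentiableAt ℝ (fun y => fderiv ℝ g y c • a) x := hdc.smul (differentiableAt_const a)
  rw [divergence_sub_apply h1 h2]
  have e1 : VectorCalculus.divergence (fun y => fderiv ℝ g y a • c) x =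
      fderiv ℝ (fun y => fderiv ℝ g y a) x c := by
    have h := divergence_smul_apply (θ := fun y => fderiv ℝ g y a) (u := fun _ : E => c) hda
      (differentiableAt_const c)
    have h0 : VectorCalculus.divergence (fun _ : E => c) x = 0 := by simp [VectorCalculus.divergence]
    rw [h0, mul_zero, zero_add, inner_gradient_eq_fderiv_apply] at h
    exact h
  have e2 : VectorCalculus.divergence (fun y => fderiv ℝ g y c • a) x =
      fderiv ℝ (fun y => fderiv ℝ g y c) x a := by
    have h := divergence_smul_apply (θ := fun y => fderiv ℝ g y c) (u := fun _ : E => a) hdc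
      (differentiableAt_const a)
    have h0 : VectorCalculus.divergence (fun _ : E => a) x = 0 := by simp [VectorCalculus.divergence]
    rw [h0, mul_zero, zero_add, inner_gradient_eq_fderiv_apply] at h
    exact h
  rw [e1, e2, fderiv_fderiv_apply_comm hg x c a, sub_self]

omit [MeasurableSpace E] [BorelSpace E] in
/-- The gradient in an orthonormal frame: `∇h(x) = Σᵢ (∂ᵢh)(x) eᵢ`. [folklore] -/
theorem gradient_eq_sum_fderiv_smul {ι : Type*} [Fintype ι] (b : OrthonormalBasis ι ℝ E)
    (h : E → ℝ) (x : E) : gradient h x = ∑ i, fderiv ℝ h x (b i) • b i := by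
  conv_lhs => rw [← b.sum_repr' (gradient h x)]
  refine Finset.sum_congr rfl fun i _ => ?_
  rw [inner_gradient_eq_fderiv_apply]

omit [MeasurableSpace E] [BorelSpace E] in
/-- **`(Δθ) a = ∇(∂ₐθ) + Σᵢ [(∂ᵢ∂ᵢθ) a - (∂ₐ∂ᵢθ) eᵢ]`** pointwise, for `θ ∈ C²` and any
orthonormal frame `eᵢ` (Schwarz: `Σᵢ (∂ₐ∂ᵢθ) eᵢ = Σᵢ (∂ᵢ∂ₐθ) eᵢ = ∇(∂ₐθ)`); the summands are
the curl-type fields of the partial derivatives `∂ᵢθ`. This is the vector identity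
`(ΔF) = ∇ div F - curl curl F` for `F = θ a`. [folklore] -/
theorem laplacian_smul_eq_gradient_add_sum_curlPair {ι : Type*} [Fintype ι] (b : OrthonormalBasis ι ℝ E)
    {θ : E → ℝ} (hθ : ContDiff ℝ 2 θ) (a x : E) :
    (Δ θ) x • a = gradient (fun y => fderiv ℝ θ y a) x +
      ∑ i, (fderiv ℝ (fun y => fderiv ℝ θ y (b i)) x (b i) • a -
        fderiv ℝ (fun y => fderiv ℝ θ y (b i)) x a • b i) := by
  rw [Finset.sum_sub_distrib, ← Finset.sum_smul, ← laplacian_eq_sum_fderiv_fderiv b hθ x,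
    gradient_eq_sum_fderiv_smul b]
  have hsw : ∑ i, fderiv ℝ (fun y => fderiv ℝ θ y (b i)) x a • b i =
      ∑ i, fderiv ℝ (fun y => fderiv ℝ θ y a) x (b i) • b i :=
    Finset.sum_congr rfl fun i _ => by rw [fderiv_fderiv_apply_comm hθ x a (b i)]
  rw [hsw]
  abel

/-- **Weak harmonicity from weak divergence- and curl-freeness.** Let `w ∈ L¹_loc(E; E)` be
weakly divergence free and annihilate every curl-type field `(∂ₐg) c - (∂_c g) a` of a scalar
test function `g`. Then every component of `w` is weakly harmonic: `∫ Δθ ⟪w, a⟫ = 0`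
(pair `w` with the pointwise identity `laplacian_smul_eq_gradient_add_sum_curlPair`; the
gradient term vanishes by `div w = 0` weakly and the curl terms by hypothesis; Lemarié-Rieusset
2016, proof of Thm. 4.4, pp. 56–57, weak form). [cite: LemarieRieusset2016, proof of Thm. 4.4 (uniqueness part) pp. 56–57] -/
theorem integral_laplacian_mul_inner_eq_zero_of_curlPair {w : E → E}
    (hwl : LocallyIntegrable w (volume : Measure E)) (hdiv : IsWeaklyDivFree w)
    (hcurl : ∀ g : E → ℝ, FunctionSpaces.IsTestFunctionOn (⊤ : Opens E) g → ∀ a c : E,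
      ∫ x, ⟪w x, fderiv ℝ g x a • c - fderiv ℝ g x c • a⟫ = 0)
    {θ : E → ℝ} (hθ : FunctionSpaces.IsTestFunctionOn (⊤ : Opens E) θ) (a : E) :
    ∫ x, (Δ θ) x * ⟪w x, a⟫ = 0 := by
  set b := stdOrthonormalBasis ℝ E
  have hθ2 : ContDiff ℝ 2 θ := contDiff_infty.1 hθ.contDiff 2
  -- the test functions involved
  have hga : FunctionSpaces.IsTestFunctionOn (⊤ : Opens E) (fun y => fderiv ℝ θ y a) :=
    hθ.fderiv_apply_const a
  have hgi : ∀ i, FunctionSpaces.IsTestFunctionOn (⊤ : Opens E) (fun y => fderiv ℝ θ y (b i)) :=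
    fun i => hθ.fderiv_apply_const (b i)
  -- the gradient term
  have hG_smooth : ContDiff ℝ (⊤ : ℕ∞) (gradient fun y => fderiv ℝ θ y a) := by
    refine contDiff_infty.2 fun n => ?_
    exact (InnerProductSpace.toDual ℝ E).symm.contDiff.comp
      (hga.contDiff.fderiv_right (m := n) (by exact_mod_cast le_top))
  have hG_supp : HasCompactSupport (gradient fun y => fderiv ℝ θ y a) :=
    (hga.hasCompactSupport.fderiv (𝕜 := ℝ)).comp_left
      (g := (InnerProductSpace.toDual ℝ E).symm) (map_zero _)
  have iG : Integrable (fun x => ⟪w x, gradient (fun y => fderiv ℝ θ y a) x⟫) volume :=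
    integrable_inner_of_locallyIntegrable_of_hasCompactSupport hwl hG_smooth.continuous hG_supp
  have eG : ∫ x, ⟪w x, gradient (fun y => fderiv ℝ θ y a) x⟫ = 0 := hdiv _ hga
  -- the curl terms
  set K : Fin (Module.finrank ℝ E) → E → E := fun i x =>
    fderiv ℝ (fun y => fderiv ℝ θ y (b i)) x (b i) • a -
      fderiv ℝ (fun y => fderiv ℝ θ y (b i)) x a • b i with hK_def
  have hKt : ∀ i, FunctionSpaces.IsTestFunctionOn (⊤ : Opens E) (K i) := fun i =>
    isTestFunctionOn_curlPair (hgi i) (b i) a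
  have iK : ∀ i, Integrable (fun x => ⟪w x, K i x⟫) volume := fun i =>
    integrable_inner_of_locallyIntegrable_of_hasCompactSupport hwl (hKt i).contDiff.continuous
      (hKt i).hasCompactSupport
  have eK : ∀ i, ∫ x, ⟪w x, K i x⟫ = 0 := fun i => hcurl _ (hgi i) (b i) a
  -- pair the pointwise identity with `w`
  have hpt : ∀ x, (Δ θ) x * ⟪w x, a⟫ =
      ⟪w x, gradient (fun y => fderiv ℝ θ y a) x⟫ + ∑ i, ⟪w x, K i x⟫ := fun x => by
    rw [← real_inner_smul_right, laplacian_smul_eq_gradient_add_sum_curlPair b hθ2 a x,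
      inner_add_right, inner_sum]
  simp_rw [hpt]
  rw [integral_add iG (integrable_finsetSum _ fun i _ => iK i), integral_finsetSum _ fun i _ => iK i,
    eG, zero_add]
  exact Finset.sum_eq_zero fun i _ => eK i

end CurlPair

/-! ### The `div`–`curl` annihilator lemma -/

section Annihilator

/-- **The `div`–`curl` annihilator lemma in `L^p + L^q`.** Let `1 < p, q < ∞` and
`w = w₁ + w₂` with `w₁ ∈ L^p(E; E)`, `w₂ ∈ L^q(E; E)`, weakly divergence free
(`∫ ⟪w, ∇θ⟫ = 0`) and weakly irrotational in the sense that `∫ ⟪w, (∂ₐg) c - (∂_c g) a⟫ = 0`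
for every scalar test function `g` and all `a, c ∈ E`. Then `w = 0` a.e.: its components are
weakly harmonic (`integral_laplacian_mul_inner_eq_zero_of_curlPair`) and Weyl–Liouville applies
(Lemarié-Rieusset 2016, proof of Thm. 4.4, pp. 56–57: a solenoidal irrotational field small at
infinity vanishes). [cite: LemarieRieusset2016, proof of Thm. 4.4 (uniqueness part) pp. 56–57] -/
theorem IsWeaklyDivFree.ae_eq_zero_of_add_memLp_of_forall_integral_inner_curlPair_eq_zero
    {p q : ℝ≥0∞} (hp : 1 < p) (hp' : p < (⊤ : ℝ≥0∞)) (hq : 1 < q) (hq' : q < (⊤ : ℝ≥0∞))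
    {w₁ w₂ : E → E} (hw₁ : MemLp w₁ p (volume : Measure E)) (hw₂ : MemLp w₂ q (volume : Measure E))
    (hdiv : IsWeaklyDivFree (w₁ + w₂))
    (hcurl : ∀ g : E → ℝ, FunctionSpaces.IsTestFunctionOn (⊤ : Opens E) g → ∀ a c : E,
      ∫ x, ⟪(w₁ + w₂) x, fderiv ℝ g x a • c - fderiv ℝ g x c • a⟫ = 0) :
    w₁ + w₂ =ᵐ[volume] 0 :=
  ae_eq_zero_of_forall_integral_laplacian_mul_inner_eq_zero hp hp' hq hq' hw₁ hw₂
    fun _ hθ a => integral_laplacian_mul_inner_eq_zero_of_curlPair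
      ((hw₁.locallyIntegrable hp.le).add (hw₂.locallyIntegrable hq.le)) hdiv hcurl hθ a

/-- The `div`–`curl` annihilator lemma in `L^p`: the case `w₂ = 0`. [cite: LemarieRieusset2016, proof of Thm. 4.4 (uniqueness part) pp. 56–57] -/
theorem IsWeaklyDivFree.ae_eq_zero_of_memLp_of_forall_integral_inner_curlPair_eq_zero
    {p : ℝ≥0∞} (hp : 1 < p) (hp' : p < (⊤ : ℝ≥0∞)) {w : E → E} (hw : MemLp w p (volume : Measure E))
    (hdiv : IsWeaklyDivFree w)
    (hcurl : ∀ g : E → ℝ, FunctionSpaces.IsTestFunctionOn (⊤ : Opens E) g → ∀ a c : E,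
      ∫ x, ⟪w x, fderiv ℝ g x a • c - fderiv ℝ g x c • a⟫ = 0) :
    w =ᵐ[volume] 0 := by
  have h := IsWeaklyDivFree.ae_eq_zero_of_add_memLp_of_forall_integral_inner_curlPair_eq_zero
    (w₁ := w) (w₂ := 0) hp hp' ENNReal.one_lt_two ENNReal.ofNat_lt_top hw MemLp.zero
    (by simpa using hdiv) (by simpa using hcurl)
  simpa using h

end Annihilator

/-! ### `L²` bounds by duality with curl-type fields -/

section Duality

/-- **`L²` bounds by duality with curl-type test fields.** Let `f ∈ L^p(E; E)`, `1 < p < ∞`,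
be weakly divergence free, and suppose `|∫ ⟪f, φ⟫| ≤ A ‖φ‖_{L²}` for every `φ` in the span
`𝒦` of the curl-type fields `(∂ₐg) c - (∂_c g) a` of scalar test functions `g`. Then `f ∈ L²`
with `‖f‖_{L²} ≤ A`. Proof: the functional `φ ↦ ∫⟪f, φ⟫` on `𝒦` is represented (Riesz, after
extension to the `L²`-closure of `𝒦`, `exists_Lp_repr_of_forall_abs_le`) by some `h` with
`‖h‖ ≤ A` lying in `L²_σ ⊇ closure 𝒦`, hence weakly divergence free; `h - f ∈ L² + L^p` is
weakly divergence free and annihilates `𝒦`, so `h = f` a.e. by the `div`–`curl` annihilator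
lemma. (The analogue for all divergence-free tests is the tree's
`memLp_two_of_forall_abs_integral_inner_le`; Temam 1977, Ch. I, Thm. 1.4 / Rem. 1.6.) [cite: Temam1977, Ch. I Thm. 1.4 and Rem. 1.6] -/
theorem memLp_two_of_forall_abs_integral_inner_curlPair_le {p : ℝ≥0∞} (hp : 1 < p)
    (hp' : p < (⊤ : ℝ≥0∞)) {f : E → E} (hf : MemLp f p (volume : Measure E))
    (hdiv : IsWeaklyDivFree f) {A : ℝ} (hA : 0 ≤ A)
    (hbd : ∀ φ ∈ Submodule.span ℝ {φ : E → E | ∃ (g : E → ℝ) (a c : E),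
        FunctionSpaces.IsTestFunctionOn (⊤ : Opens E) g ∧
          φ = fun x => fderiv ℝ g x a • c - fderiv ℝ g x c • a},
      |∫ x, ⟪f x, φ x⟫| ≤ A * (eLpNorm φ 2 (volume : Measure E)).toReal) :
    MemLp f 2 (volume : Measure E) ∧ eLpNorm f 2 (volume : Measure E) ≤ ENNReal.ofReal A := by
  set S : Set (E → E) := {φ : E → E | ∃ (g : E → ℝ) (a c : E),
    FunctionSpaces.IsTestFunctionOn (⊤ : Opens E) g ∧
      φ = fun x => fderiv ℝ g x a • c - fderiv ℝ g x c • a} with hS_def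
  set K : Submodule ℝ (E → E) := Submodule.span ℝ S with hK_def
  have hKle : K ≤ divFreeTest E := by
    refine Submodule.span_le.2 ?_
    rintro φ ⟨g, a, c, hg, rfl⟩
    exact ⟨isTestFunctionOn_curlPair hg a c, isDivFree_curlPair_of_contDiff (contDiff_infty.1 hg.contDiff 2) a c⟩
  have hKmem : ∀ φ ∈ K, MemLp φ 2 (volume : Measure E) := fun φ hφ =>
    memLp_of_mem_divFreeTest (hKle hφ) 2
  have hfl : LocallyIntegrable f volume := hf.locallyIntegrable hp.le
  have hint : ∀ φ : K, Integrable (fun x => ⟪f x, (φ : E → E) x⟫) volume := fun φ =>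
    integrable_inner_of_locallyIntegrable_of_hasCompactSupport hfl (hKle φ.2).1.contDiff.continuous
      (hKle φ.2).1.hasCompactSupport
  -- the functional `ℓ(φ) = ∫⟪f, φ⟫` on `𝒦`
  set ℓ : K →ₗ[ℝ] ℝ :=
    { toFun := fun φ => ∫ x, ⟪f x, (φ : E → E) x⟫
      map_add' := fun φ ψ => by
        simp only [Submodule.coe_add, Pi.add_apply, inner_add_right]
        exact integral_add (hint φ) (hint ψ)
      map_smul' := fun c φ => by
        simp only [Submodule.coe_smul, Pi.smul_apply, real_inner_smul_right, RingHom.id_apply,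
          smul_eq_mul]
        exact integral_const_mul _ _ } with hℓ_def
  have hℓ : ∀ φ : K, |ℓ φ| ≤ A * (eLpNorm (φ : E → E) 2 (volume : Measure E)).toReal :=
    fun φ => hbd φ φ.2
  obtain ⟨w, hwA, hwrep, hwS⟩ := exists_Lp_repr_of_forall_abs_le K hKmem ℓ hA hℓ
  -- `w ∈ L²_σ`, hence weakly divergence free
  have hwsol : w ∈ solenoidalL2 E :=
    hwS (solenoidalL2 E) (Submodule.isClosed_topologicalClosure _) fun φ =>
      divFreeTestToL2_mem ⟨(φ : E → E), hKle φ.2⟩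
  set g : E → E := ((w : Lp E 2 (volume : Measure E)) : E → E) with hg_def
  have hgm : MemLp g 2 (volume : Measure E) := Lp.memLp w
  have hgdiv : IsWeaklyDivFree g := isWeaklyDivFree_of_mem_solenoidalL2 hwsol
  have hg_pair : ∀ φ : K, ∫ x, ⟪g x, (φ : E → E) x⟫ = ∫ x, ⟪f x, (φ : E → E) x⟫ := fun φ =>
    hwrep φ
  -- `g - f` annihilates the curl-type fields, is weakly divergence free, in `L² + L^p`: zero a.e.
  have hcurl : ∀ g' : E → ℝ, FunctionSpaces.IsTestFunctionOn (⊤ : Opens E) g' → ∀ a c : E,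
      ∫ x, ⟪(g + -f) x, fderiv ℝ g' x a • c - fderiv ℝ g' x c • a⟫ = 0 := fun g' hg' a c => by
    have hmem : (fun x => fderiv ℝ g' x a • c - fderiv ℝ g' x c • a) ∈ K :=
      Submodule.subset_span ⟨g', a, c, hg', rfl⟩
    have hφt := (hKle hmem).1
    have ig : Integrable (fun x => ⟪g x, fderiv ℝ g' x a • c - fderiv ℝ g' x c • a⟫) volume :=
      integrable_inner_of_locallyIntegrable_of_hasCompactSupport (hgm.locallyIntegrable one_le_two)
        hφt.contDiff.continuous hφt.hasCompactSupport
    simp only [Pi.add_apply, Pi.neg_apply, inner_add_left, inner_neg_left]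
    have i2 : Integrable (fun x => -⟪f x, fderiv ℝ g' x a • c - fderiv ℝ g' x c • a⟫) volume :=
      (hint ⟨_, hmem⟩).neg
    rw [integral_add ig i2, integral_neg]
    have hp := hg_pair ⟨_, hmem⟩
    simp only at hp
    rw [hp]
    exact add_neg_cancel _
  have hsum : IsWeaklyDivFree (g + -f) := by
    have h1 := hgdiv.sub_of_locallyIntegrable hdiv (hgm.locallyIntegrable one_le_two) hfl
    rwa [sub_eq_add_neg] at h1
  have hae := IsWeaklyDivFree.ae_eq_zero_of_add_memLp_of_forall_integral_inner_curlPair_eq_zero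
    (w₁ := g) (w₂ := -f) ENNReal.one_lt_two ENNReal.ofNat_lt_top hp hp' hgm hf.neg hsum hcurl
  have hfg : f =ᵐ[volume] g := by
    filter_upwards [hae] with x hx
    have hx' : g x + -f x = 0 := hx
    rw [← sub_eq_add_neg, sub_eq_zero] at hx'
    exact hx'.symm
  refine ⟨hgm.ae_eq hfg.symm, ?_⟩
  rw [eLpNorm_congr_ae hfg, hg_def, ← Lp.enorm_def, ← ofReal_norm]
  exact ENNReal.ofReal_le_ofReal hwA

end Duality

end Literature.Analysis.FluidPDE
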